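import Literature.Analysis.FluidPDE.BilliardTensorMeasurePairing
import Literature.Analysis.FluidPDE.BilliardTensorDivFree
import HarnessLib

/-!
# `Div M = 0` for Serre's billiard tensor measure, tested against space–time gradients

Capstone of the block `BilliardTensorDivFree` / `BilliardTensorMeasure*`: for the matrix-valued
measure `M = billiardTensor ε γ a b` on `ℝ × T^d` (D. Serre's mass–momentum tensor with collitons
of a hard-sphere motion, Serre 2024 §5 p. 1438) and a `C¹` space–time test vector field
`Ψ = (ψ₀, ψ)` vanishing on the time slices `t = a` and `t = b`, the duality pairing of `M` with the
space–time Jacobian matrix field `G = ∇_{t,y} Ψ` (`G_{αβ} = ∂_β Ψ_α`, `α, β ∈ {t} ⊔ d`) vanishes: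

`⟨M, ∇Ψ⟩ = Σ_{αβ} ∫ ∂_β Ψ_α dM_{αβ} = 0`,

i.e. `Div M = 0` in `𝒟'((a, b) × T^d)` row-wise. Proof: the closed form of the pairing
(`IsHardSphereTrajectory.pairing_billiardTensor`) is identified summand by summand with the
tested functionals — `Σ_{αβ} (u_p)_α (u_p)_β ∂_βΨ_α = Dψ₀(1, v_p) + ⟪Dψ(1, v_p), v_p⟫`
(`stMomentumStreaming`) and `Σ_{αβ} [Δv]_α [Δv]_β ∂_βΨ_α = ⟪D_yψ [Δv], [Δv]⟫`
(`collitonKernel`) — and the tested identity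
`integral_stMomentumStreaming_add_collitonPairing_eq_zero` of `BilliardTensorDivFree` concludes.

* `stBasis β` — the space–time unit vectors `E_t = (1, 0)`, `E_j = (0, e_j)`;
  `stGradMatrix ψ₀ ψ q` — the matrix `(∂_β Ψ_α)(q)` built from `Torus.stFDeriv`;
* `Torus.stFDeriv_inr` — `D Ψ (t, y) (0, w) = D_y (Ψ t) y w` (space directions of the space–time
  derivative are the torus derivative of the frozen slice);
* `sum_stVec_mul_stGradMatrix`, `sum_stVec_zero_mul_stGradMatrix` — the two quadratic-form
  identities above;
* **`IsHardSphereTrajectory.pairing_billiardTensor_stGradMatrix_eq_zero`** — `⟨M, ∇Ψ⟩ = 0`.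

Hypotheses: `ψ₀, ψ` jointly `C¹` with bounded space–time derivatives (test functions), vanishing
at `t = a, b`. Not here: determinantal masses (Serre 2024 (15)).

## References

* D. Serre, *Compensated integrability on tori; a priori estimate for space-periodic gas flows*,
  C. R. Math. Acad. Sci. Paris 362 (2024) 1425–1444, §5 p. 1438. [Serre2024]
-/

open Set Filter Function MeasureTheory
open scoped InnerProductSpace Topology

namespace Literature.Analysis.FluidPDE

noncomputable section

open Literature.Analysis.FunctionSpaces

variable {d : Type*} [Fintype d] [DecidableEq d] {N : ℕ}

/-! ## Space–time gradients as `Option d`-indexed matrices -/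

/-- The space–time unit vectors: `E_none = (1, 0)` (time), `E_{some j} = (0, e_j)`. [folklore] -/
def stBasis (β : Option d) : ℝ × EuclideanSpace ℝ d :=
  β.elim (1, 0) fun j => (0, EuclideanSpace.single j 1)

omit [Fintype d] in
/-- Time unit vector. [folklore] -/
@[simp] theorem stBasis_none : (stBasis none : ℝ × EuclideanSpace ℝ d) = (1, 0) := rfl

omit [Fintype d] in
/-- Space unit vectors. [folklore] -/
@[simp] theorem stBasis_some (j : d) :
    (stBasis (some j) : ℝ × EuclideanSpace ℝ d) = (0, EuclideanSpace.single j 1) := rfl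

/-- Expansion of a space–time vector on the space–time basis: `Σ_β (c, v)_β E_β = (c, v)`.
[folklore] -/
theorem sum_stVec_smul_stBasis (c : ℝ) (v : EuclideanSpace ℝ d) :
    ∑ β : Option d, stVec c v β • (stBasis β : ℝ × EuclideanSpace ℝ d) = (c, v) := by
  have hv : ∑ j : d, v j • EuclideanSpace.single j (1 : ℝ) = v := by
    have h := (EuclideanSpace.basisFun d ℝ).sum_repr v
    simpa only [EuclideanSpace.basisFun_apply, EuclideanSpace.basisFun_repr] using h
  rw [Fintype.sum_option]
  refine Prod.ext ?_ ?_
  · simp [Prod.fst_sum]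
  · simp only [stVec_none, stBasis_none, stVec_some, stBasis_some, Prod.smul_mk, smul_zero,
      Prod.snd_add, Prod.snd_sum]
    simpa using hv

/-- The space–time **Jacobian matrix field** `G = ∇_{t,y}Ψ` of `Ψ = (ψ₀, ψ)`:
`G (t, x) α β = ∂_β Ψ_α (t, x)` with `Ψ_none = ψ₀`, `Ψ_{some k} = ψ^k`, `∂_none = ∂_t`,
`∂_{some j} = ∂_{y_j}` (through `Torus.stFDeriv`). [cite: Serre2024, §5 p. 1438] -/
def stGradMatrix (ψ₀ : ℝ → UnitAddTorus d → ℝ) (ψ : ℝ → UnitAddTorus d → EuclideanSpace ℝ d)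
    (q : ℝ × UnitAddTorus d) : Matrix (Option d) (Option d) ℝ :=
  Matrix.of fun α β =>
    α.elim (Torus.stFDeriv ψ₀ q.1 q.2 (stBasis β)) fun k => Torus.stFDeriv ψ q.1 q.2 (stBasis β) k

/-- Contracting the Jacobian matrix with `u ⊗ u`, `u = (1, v)`:
`Σ_{αβ} u_α u_β ∂_βΨ_α = Dψ₀(1, v) + ⟪Dψ(1, v), v⟫` — the summand of `stMomentumStreaming`.
[folklore] -/
theorem sum_stVec_mul_stGradMatrix (ψ₀ : ℝ → UnitAddTorus d → ℝ)
    (ψ : ℝ → UnitAddTorus d → EuclideanSpace ℝ d) (q : ℝ × UnitAddTorus d) (v : EuclideanSpace ℝ d) :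
    ∑ α : Option d, ∑ β : Option d, stGradMatrix ψ₀ ψ q α β * (stVec 1 v α * stVec 1 v β) =
      Torus.stFDeriv ψ₀ q.1 q.2 (1, v) + ⟪Torus.stFDeriv ψ q.1 q.2 (1, v), v⟫_ℝ := by
  -- inner sums: linearity in `β`
  have h0 : ∑ β : Option d, stVec 1 v β * Torus.stFDeriv ψ₀ q.1 q.2 (stBasis β) =
      Torus.stFDeriv ψ₀ q.1 q.2 (1, v) := by
    rw [← sum_stVec_smul_stBasis 1 v, map_sum]
    simp only [map_smul, smul_eq_mul]
  have h1 : ∀ k : d, ∑ β : Option d, stVec 1 v β * Torus.stFDeriv ψ q.1 q.2 (stBasis β) k =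
      Torus.stFDeriv ψ q.1 q.2 (1, v) k := by
    intro k
    rw [← sum_stVec_smul_stBasis 1 v, map_sum, WithLp.ofLp_sum, Finset.sum_apply]
    simp only [map_smul, WithLp.ofLp_smul, Pi.smul_apply, smul_eq_mul]
  rw [Fintype.sum_option]
  simp only [stGradMatrix, Matrix.of_apply, Option.elim_none, Option.elim_some, stVec_none, one_mul,
    stVec_some]
  have e0 : ∑ β : Option d, Torus.stFDeriv ψ₀ q.1 q.2 (stBasis β) * stVec 1 v β =
      Torus.stFDeriv ψ₀ q.1 q.2 (1, v) := by
    rw [← h0]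
    exact Finset.sum_congr rfl fun β _ => mul_comm _ _
  have e1 : ∑ k : d, ∑ β : Option d, Torus.stFDeriv ψ q.1 q.2 (stBasis β) k * (v k * stVec 1 v β) =
      ⟪Torus.stFDeriv ψ q.1 q.2 (1, v), v⟫_ℝ := by
    rw [PiLp.inner_apply]
    refine Finset.sum_congr rfl fun k _ => ?_
    rw [← h1 k]
    simp only [RCLike.inner_apply, conj_trivial, Finset.mul_sum]
    exact Finset.sum_congr rfl fun β _ => by ring
  rw [e0, e1]

/-- Contracting the Jacobian matrix with `z ⊗ z`, `z = (0, w)` (a colliton direction):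
`Σ_{αβ} z_α z_β ∂_βΨ_α = ⟪D Ψ (0, w), w⟫` (only space rows and columns). [folklore] -/
theorem sum_stVec_zero_mul_stGradMatrix (ψ₀ : ℝ → UnitAddTorus d → ℝ)
    (ψ : ℝ → UnitAddTorus d → EuclideanSpace ℝ d) (q : ℝ × UnitAddTorus d) (w : EuclideanSpace ℝ d) :
    ∑ α : Option d, ∑ β : Option d, stGradMatrix ψ₀ ψ q α β * (stVec 0 w α * stVec 0 w β) =
      ⟪Torus.stFDeriv ψ q.1 q.2 (0, w), w⟫_ℝ := by
  have h1 : ∀ k : d, ∑ β : Option d, stVec 0 w β * Torus.stFDeriv ψ q.1 q.2 (stBasis β) k =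
      Torus.stFDeriv ψ q.1 q.2 (0, w) k := by
    intro k
    rw [← sum_stVec_smul_stBasis 0 w, map_sum, WithLp.ofLp_sum, Finset.sum_apply]
    simp only [map_smul, WithLp.ofLp_smul, Pi.smul_apply, smul_eq_mul]
  rw [Fintype.sum_option]
  simp only [stGradMatrix, Matrix.of_apply, Option.elim_none, Option.elim_some, stVec_none, zero_mul,
    mul_zero, Finset.sum_const_zero, zero_add, stVec_some]
  rw [PiLp.inner_apply]
  refine Finset.sum_congr rfl fun k _ => ?_
  rw [← h1 k]
  simp only [RCLike.inner_apply, conj_trivial, Finset.mul_sum]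
  exact Finset.sum_congr rfl fun β _ => by ring

omit [DecidableEq d] in
/-- **Space directions of the space–time derivative**: for a jointly `C¹` field,
`D Ψ (t, y) (0, w) = D_y (Ψ t) y w` (`Torus.fderiv` of the frozen slice): the re-centred lift of
the slice is the re-centred space–time lift composed with `w ↦ (0, w)`. [folklore] -/
theorem Torus.stFDeriv_inr {F : Type*} [NormedAddCommGroup F] [NormedSpace ℝ F]
    {ψ : ℝ → UnitAddTorus d → F} (hψ : ContDiff ℝ 1 (Torus.stLift ψ)) (t : ℝ) (y : UnitAddTorus d)
    (w : EuclideanSpace ℝ d) : Torus.stFDeriv ψ t y (0, w) = Torus.fderiv (ψ t) y w := by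
  have hfun : Torus.liftAt (ψ t) y =
      Torus.stLiftAt ψ t y ∘ fun w' : EuclideanSpace ℝ d => ((0 : ℝ), w') := by
    funext w'
    simp only [Function.comp_apply, Torus.liftAt_apply, Torus.stLiftAt_apply, add_zero]
  have hd : HasFDerivAt (Torus.stLiftAt ψ t y) (Torus.stFDeriv ψ t y) ((0 : ℝ), (0 : EuclideanSpace ℝ d)) :=
    (((Torus.contDiff_stLiftAt hψ t y).differentiable one_ne_zero) _).hasFDerivAt
  have hcomp := hd.comp (0 : EuclideanSpace ℝ d) (hasFDerivAt_prodMk_right (0 : ℝ) (0 : EuclideanSpace ℝ d))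
  rw [← hfun] at hcomp
  rw [Torus.fderiv, hcomp.fderiv]
  rfl

omit [DecidableEq d] in
/-- The space–time derivative read through the global lift at the canonical representative.
[folklore] -/
theorem Torus.stFDeriv_eq_fderiv_stLift_repr {F : Type*} [NormedAddCommGroup F] [NormedSpace ℝ F]
    (ψ : ℝ → UnitAddTorus d → F) (t : ℝ) (x : UnitAddTorus d) :
    Torus.stFDeriv ψ t x = fderiv ℝ (Torus.stLift ψ) (t, Torus.repr x) := by
  rw [Torus.fderiv_stLift, Torus.proj_repr]

omit [DecidableEq d] in
/-- Entries of the space–time derivative of a jointly `C¹` field, applied to a fixed vector, are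
measurable on `ℝ × T^d`. [folklore] -/
theorem Torus.measurable_stFDeriv_apply {F : Type*} [NormedAddCommGroup F] [NormedSpace ℝ F]
    [MeasurableSpace F] [BorelSpace F] {ψ : ℝ → UnitAddTorus d → F} (hψ : ContDiff ℝ 1 (Torus.stLift ψ))
    (e : ℝ × EuclideanSpace ℝ d) :
    Measurable fun q : ℝ × UnitAddTorus d => Torus.stFDeriv ψ q.1 q.2 e := by
  have hc : Continuous fun p : ℝ × EuclideanSpace ℝ d => fderiv ℝ (Torus.stLift ψ) p e :=
    (hψ.continuous_fderiv one_ne_zero).clm_apply continuous_const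
  have hm : Measurable fun q : ℝ × UnitAddTorus d => ((q.1, Torus.repr q.2) : ℝ × EuclideanSpace ℝ d) :=
    measurable_fst.prodMk (Torus.measurable_repr.comp measurable_snd)
  have heq : (fun q : ℝ × UnitAddTorus d => Torus.stFDeriv ψ q.1 q.2 e) =
      (fun p : ℝ × EuclideanSpace ℝ d => fderiv ℝ (Torus.stLift ψ) p e) ∘
        fun q : ℝ × UnitAddTorus d => ((q.1, Torus.repr q.2) : ℝ × EuclideanSpace ℝ d) := by
    funext q
    simp only [Function.comp_apply, Torus.stFDeriv_eq_fderiv_stLift_repr]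
  rw [heq]
  exact hc.measurable.comp hm

omit [DecidableEq d] in
/-- Bound on the space–time derivative applied to a vector. [folklore] -/
theorem Torus.norm_stFDeriv_apply_le {F : Type*} [NormedAddCommGroup F] [NormedSpace ℝ F]
    {ψ : ℝ → UnitAddTorus d → F} {C : ℝ} (hb : ∀ p, ‖fderiv ℝ (Torus.stLift ψ) p‖ ≤ C) (t : ℝ)
    (x : UnitAddTorus d) (e : ℝ × EuclideanSpace ℝ d) : ‖Torus.stFDeriv ψ t x e‖ ≤ C * ‖e‖ := by
  rw [Torus.stFDeriv_eq_fderiv_stLift_repr]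
  exact (ContinuousLinearMap.le_opNorm _ _).trans (mul_le_mul_of_nonneg_right (hb _) (norm_nonneg _))

/-- The space–time unit vectors have norm at most `1`. [folklore] -/
theorem norm_stBasis_le (β : Option d) : ‖(stBasis β : ℝ × EuclideanSpace ℝ d)‖ ≤ 1 := by
  cases β with
  | none => simp [Prod.norm_def]
  | some j => simp [Prod.norm_def]

/-- The entries of the Jacobian matrix of test fields with space–time derivatives bounded by
`C` are measurable and bounded by `C`. [folklore] -/
theorem stGradMatrix_measurable_and_bounded {ψ₀ : ℝ → UnitAddTorus d → ℝ}
    {ψ : ℝ → UnitAddTorus d → EuclideanSpace ℝ d} (hψ₀ : ContDiff ℝ 1 (Torus.stLift ψ₀))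
    (hψ : ContDiff ℝ 1 (Torus.stLift ψ)) {C : ℝ} (hb₀ : ∀ p, ‖fderiv ℝ (Torus.stLift ψ₀) p‖ ≤ C)
    (hb : ∀ p, ‖fderiv ℝ (Torus.stLift ψ) p‖ ≤ C) :
    (∀ α β, Measurable fun q => stGradMatrix ψ₀ ψ q α β) ∧
      ∀ q α β, |stGradMatrix ψ₀ ψ q α β| ≤ C := by
  have hC : 0 ≤ C := (norm_nonneg _).trans (hb₀ (0, 0))
  constructor
  · intro α β
    cases α with
    | none =>
      simp only [stGradMatrix, Matrix.of_apply, Option.elim_none]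
      exact Torus.measurable_stFDeriv_apply hψ₀ _
    | some k =>
      simp only [stGradMatrix, Matrix.of_apply, Option.elim_some]
      exact (EuclideanSpace.proj k).continuous.measurable.comp (Torus.measurable_stFDeriv_apply hψ _)
  · intro q α β
    have hE := norm_stBasis_le (d := d) β
    cases α with
    | none =>
      simp only [stGradMatrix, Matrix.of_apply, Option.elim_none]
      have h := Torus.norm_stFDeriv_apply_le hb₀ q.1 q.2 (stBasis β)
      rw [Real.norm_eq_abs] at h
      exact h.trans (by nlinarith)
    | some k =>
      simp only [stGradMatrix, Matrix.of_apply, Option.elim_some]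
      have h := Torus.norm_stFDeriv_apply_le hb q.1 q.2 (stBasis β)
      have hk : |Torus.stFDeriv ψ q.1 q.2 (stBasis β) k| ≤ ‖Torus.stFDeriv ψ q.1 q.2 (stBasis β)‖ := by
        have := abs_stVec_le 0 (Torus.stFDeriv ψ q.1 q.2 (stBasis β)) (some k)
        simpa using this
      exact hk.trans (h.trans (by nlinarith))

/-! ## `⟨M, ∇Ψ⟩ = 0` -/

namespace IsHardSphereTrajectory

variable {ε : ℝ} {γ : ℝ → Config N d (UnitAddTorus d)}

/-- **`Div M = 0` for the measure `M`, tested.** Along a hard-sphere trajectory on `T^d`, for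
jointly `C¹` test fields `ψ₀ : ℝ → T^d → ℝ`, `ψ : ℝ → T^d → ℝ^d` with bounded space–time
derivatives and `Ψ(a, ·) = Ψ(b, ·) = 0` (`a ≤ b`), the pairing of Serre's mass–momentum tensor
with collitons `M = billiardTensor ε γ a b` with the Jacobian matrix field `∇_{t,y}Ψ` vanishes:
`Σ_{αβ} ∫ ∂_βΨ_α dM_{αβ} = 0` — row-wise `Div M = 0` in `𝒟'((a,b) × T^d)`
(Serre 2024 §5: "summing all these contributions results in a Div-free tensor").
[cite: Serre2024, §5 p. 1438] -/
theorem pairing_billiardTensor_stGradMatrix_eq_zero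
    (h : IsHardSphereTrajectory (Torus.geometry d) ε N γ) {ψ₀ : ℝ → UnitAddTorus d → ℝ}
    {ψ : ℝ → UnitAddTorus d → EuclideanSpace ℝ d} (hψ₀ : ContDiff ℝ 1 (Torus.stLift ψ₀))
    (hψ : ContDiff ℝ 1 (Torus.stLift ψ)) {C : ℝ} (hb₀ : ∀ p, ‖fderiv ℝ (Torus.stLift ψ₀) p‖ ≤ C)
    (hb : ∀ p, ‖fderiv ℝ (Torus.stLift ψ) p‖ ≤ C) {a b : ℝ} (hab : a ≤ b) (ha₀ : ψ₀ a = 0)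
    (hb₀' : ψ₀ b = 0) (ha : ψ a = 0) (hb' : ψ b = 0) :
    (billiardTensor ε γ a b).pairing (stGradMatrix ψ₀ ψ) = 0 := by
  classical
  obtain ⟨hGm, hGC⟩ := stGradMatrix_measurable_and_bounded hψ₀ hψ hb₀ hb
  rw [h.pairing_billiardTensor a b hGm hGC]
  -- (1) the particle part is `∫_a^b stMomentumStreaming`
  set f : Option d → Option d → Fin N → ℝ → ℝ := fun α β p t =>
    stGradMatrix ψ₀ ψ (graphMap γ p t) α β * particleDensity γ p α β t with hf
  have hint : ∀ (p : Fin N) (α β : Option d), IntegrableOn (f α β p) (Icc a b) volume := by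
    intro p α β
    exact (h.integrable_particleDensity p α β a b).bdd_mul
      ((hGm α β).comp (h.measurable_graphMap p)).aestronglyMeasurable
      (ae_of_all _ fun t => by rw [Real.norm_eq_abs]; exact hGC _ α β)
  have hswap : (∑ α : Option d, ∑ β : Option d, ∑ p : Fin N, ∫ t in Icc a b, f α β p t) =
      ∫ t in Icc a b, ∑ α : Option d, ∑ β : Option d, ∑ p : Fin N, f α β p t := by
    rw [integral_finsetSum _ (fun α _ => integrable_finsetSum _ fun β _ =>
      integrable_finsetSum _ fun p _ => hint p α β)]
    refine Finset.sum_congr rfl fun α _ => ?_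
    rw [integral_finsetSum _ (fun β _ => integrable_finsetSum _ fun p _ => hint p α β)]
    refine Finset.sum_congr rfl fun β _ => ?_
    rw [integral_finsetSum _ (fun p _ => hint p α β)]
  have hpt : ∀ t, ∑ α : Option d, ∑ β : Option d, ∑ p : Fin N, f α β p t =
      stMomentumStreaming ψ₀ ψ t (γ t) := by
    intro t
    calc ∑ α : Option d, ∑ β : Option d, ∑ p : Fin N, f α β p t
        = ∑ α : Option d, ∑ p : Fin N, ∑ β : Option d, f α β p t :=
          Finset.sum_congr rfl fun α _ => Finset.sum_comm
      _ = ∑ p : Fin N, ∑ α : Option d, ∑ β : Option d, f α β p t := Finset.sum_comm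
      _ = ∑ p : Fin N, (Torus.stFDeriv ψ₀ t (γ t p).1 (1, (γ t p).2) +
            ⟪Torus.stFDeriv ψ t (γ t p).1 (1, (γ t p).2), (γ t p).2⟫_ℝ) :=
          Finset.sum_congr rfl fun p _ => sum_stVec_mul_stGradMatrix ψ₀ ψ (graphMap γ p t) (γ t p).2
      _ = stMomentumStreaming ψ₀ ψ t (γ t) := rfl
  have hpart : (∑ α : Option d, ∑ β : Option d, ∑ p : Fin N, ∫ t in Icc a b, f α β p t) =
      ∫ t in a..b, stMomentumStreaming ψ₀ ψ t (γ t) := by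
    rw [hswap, intervalIntegral.integral_of_le hab, ← integral_Icc_eq_integral_Ioc]
    exact setIntegral_congr_fun measurableSet_Icc fun t _ => hpt t
  -- (2) the colliton part is `collitonPairing`
  have hcolpt : ∀ (t : ℝ) (q : Fin N × Fin N) (y : UnitAddTorus d),
      ∑ α : Option d, ∑ β : Option d,
        collitonWeight ε (leftLim γ t) (γ t) q.1 α β * stGradMatrix ψ₀ ψ (t, y) α β =
      2⁻¹ * (ε / ‖(γ t q.1).2 - (leftLim γ t q.1).2‖) *
        ⟪Torus.fderiv (ψ t) y ((γ t q.1).2 - (leftLim γ t q.1).2),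
          (γ t q.1).2 - (leftLim γ t q.1).2⟫_ℝ := by
    intro t q y
    rw [← Torus.stFDeriv_inr hψ t y, ← sum_stVec_zero_mul_stGradMatrix ψ₀ ψ (t, y), Finset.mul_sum]
    refine Finset.sum_congr rfl fun α _ => ?_
    rw [Finset.mul_sum]
    refine Finset.sum_congr rfl fun β _ => ?_
    simp only [collitonWeight]
    ring
  have hcolint : ∀ (t : ℝ) (q : Fin N × Fin N) (α β : Option d), IntegrableOn
      (fun s : ℝ => stGradMatrix ψ₀ ψ
        (t, (γ t q.2).1 + Torus.proj (s • (Torus.geometry d).sepVec (γ t q.1).1 (γ t q.2).1)) α β)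
      (Icc (0 : ℝ) 1) volume := by
    intro t q α β
    refine IntegrableOn.of_bound measure_Icc_lt_top ?_ C (ae_of_all _ fun s => ?_)
    · exact ((hGm α β).comp (measurable_segmentMap t _ _)).aestronglyMeasurable
    · rw [Real.norm_eq_abs]; exact hGC _ α β
  have hcolterm : ∀ (t : ℝ) (q : Fin N × Fin N),
      ∑ α : Option d, ∑ β : Option d, collitonWeight ε (leftLim γ t) (γ t) q.1 α β *
        ∫ s in Icc (0 : ℝ) 1, stGradMatrix ψ₀ ψ
          (t, (γ t q.2).1 + Torus.proj (s • (Torus.geometry d).sepVec (γ t q.1).1 (γ t q.2).1)) α β =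
      collitonKernel ε (ψ t) q.1 q.2 (leftLim γ t) (γ t) := by
    intro t q
    set Gs : Option d → Option d → ℝ → ℝ := fun α β s => stGradMatrix ψ₀ ψ
      (t, (γ t q.2).1 + Torus.proj (s • (Torus.geometry d).sepVec (γ t q.1).1 (γ t q.2).1)) α β with hGs
    set w : Option d → Option d → ℝ := fun α β => collitonWeight ε (leftLim γ t) (γ t) q.1 α β with hw
    have hI : ∀ α β, IntegrableOn (fun s => w α β * Gs α β s) (Icc (0 : ℝ) 1) volume :=
      fun α β => (hcolint t q α β).const_mul _
    calc ∑ α : Option d, ∑ β : Option d, w α β * ∫ s in Icc (0 : ℝ) 1, Gs α β s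
        = ∑ α : Option d, ∑ β : Option d, ∫ s in Icc (0 : ℝ) 1, w α β * Gs α β s :=
          Finset.sum_congr rfl fun α _ => Finset.sum_congr rfl fun β _ => (integral_const_mul _ _).symm
      _ = ∑ α : Option d, ∫ s in Icc (0 : ℝ) 1, ∑ β : Option d, w α β * Gs α β s :=
          Finset.sum_congr rfl fun α _ => (integral_finsetSum _ fun β _ => hI α β).symm
      _ = ∫ s in Icc (0 : ℝ) 1, ∑ α : Option d, ∑ β : Option d, w α β * Gs α β s :=
          (integral_finsetSum _ fun α _ => integrable_finsetSum _ fun β _ => hI α β).symm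
      _ = ∫ s in Icc (0 : ℝ) 1, 2⁻¹ * (ε / ‖(γ t q.1).2 - (leftLim γ t q.1).2‖) *
            ⟪Torus.fderiv (ψ t) ((γ t q.2).1 +
                Torus.proj (s • (Torus.geometry d).sepVec (γ t q.1).1 (γ t q.2).1))
              ((γ t q.1).2 - (leftLim γ t q.1).2), (γ t q.1).2 - (leftLim γ t q.1).2⟫_ℝ :=
          setIntegral_congr_fun measurableSet_Icc fun s _ => hcolpt t q _
      _ = collitonKernel ε (ψ t) q.1 q.2 (leftLim γ t) (γ t) := by
          rw [integral_const_mul, collitonKernel, intervalIntegral.integral_of_le zero_le_one,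
            integral_Icc_eq_integral_Ioc]
  have hcoll : (∑ α : Option d, ∑ β : Option d, ∑ t ∈ (h.finite_collisionTimes_inter_Ioc a b).toFinset,
      ∑ q ∈ collidingPairs (Torus.geometry d) ε (γ t),
        collitonWeight ε (leftLim γ t) (γ t) q.1 α β *
          ∫ s in Icc (0 : ℝ) 1, stGradMatrix ψ₀ ψ
            (t, (γ t q.2).1 + Torus.proj (s • (Torus.geometry d).sepVec (γ t q.1).1 (γ t q.2).1)) α β) =
      collitonPairing ε ψ γ a b := by
    rw [collitonPairing, finsum_mem_eq_finite_toFinset_sum _ (h.finite_collisionTimes_inter_Ioc a b)]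
    calc _ = ∑ α : Option d, ∑ t ∈ (h.finite_collisionTimes_inter_Ioc a b).toFinset, ∑ β : Option d,
          ∑ q ∈ collidingPairs (Torus.geometry d) ε (γ t),
            collitonWeight ε (leftLim γ t) (γ t) q.1 α β *
              ∫ s in Icc (0 : ℝ) 1, stGradMatrix ψ₀ ψ
                (t, (γ t q.2).1 + Torus.proj (s • (Torus.geometry d).sepVec (γ t q.1).1 (γ t q.2).1)) α β :=
          Finset.sum_congr rfl fun α _ => Finset.sum_comm
      _ = ∑ t ∈ (h.finite_collisionTimes_inter_Ioc a b).toFinset, ∑ α : Option d, ∑ β : Option d,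
          ∑ q ∈ collidingPairs (Torus.geometry d) ε (γ t),
            collitonWeight ε (leftLim γ t) (γ t) q.1 α β *
              ∫ s in Icc (0 : ℝ) 1, stGradMatrix ψ₀ ψ
                (t, (γ t q.2).1 + Torus.proj (s • (Torus.geometry d).sepVec (γ t q.1).1 (γ t q.2).1)) α β :=
          Finset.sum_comm
      _ = ∑ t ∈ (h.finite_collisionTimes_inter_Ioc a b).toFinset,
          ∑ q ∈ collidingPairs (Torus.geometry d) ε (γ t), collitonKernel ε (ψ t) q.1 q.2 (leftLim γ t) (γ t) := by
          refine Finset.sum_congr rfl fun t _ => ?_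
          calc _ = ∑ α : Option d, ∑ q ∈ collidingPairs (Torus.geometry d) ε (γ t), ∑ β : Option d,
                collitonWeight ε (leftLim γ t) (γ t) q.1 α β *
                  ∫ s in Icc (0 : ℝ) 1, stGradMatrix ψ₀ ψ
                    (t, (γ t q.2).1 + Torus.proj (s • (Torus.geometry d).sepVec (γ t q.1).1 (γ t q.2).1)) α β :=
                Finset.sum_congr rfl fun α _ => Finset.sum_comm
            _ = ∑ q ∈ collidingPairs (Torus.geometry d) ε (γ t), ∑ α : Option d, ∑ β : Option d,
                collitonWeight ε (leftLim γ t) (γ t) q.1 α β *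
                  ∫ s in Icc (0 : ℝ) 1, stGradMatrix ψ₀ ψ
                    (t, (γ t q.2).1 + Torus.proj (s • (Torus.geometry d).sepVec (γ t q.1).1 (γ t q.2).1)) α β :=
                Finset.sum_comm
            _ = _ := Finset.sum_congr rfl fun q _ => hcolterm t q
  rw [hpart, hcoll]
  exact h.integral_stMomentumStreaming_add_collitonPairing_eq_zero hψ₀ hψ hab ha₀ hb₀' ha hb'

end IsHardSphereTrajectory

end

end Literature.Analysis.FluidPDE
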